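/-
Lead `ym-line-sgb-p2` (gen 1, seat prover-ym-line-sgb-p2-g1-0), route `SteinGapBootstrap`, crux item
stmt-QuantumFields-23800 `UProbeCovFromPairLaw` ≡ stmt-QuantumFields-23640 `ProbeCovFromPairLawG`, line `direct`,
STUB `stub_assembly` (bookkeeping).
-/
import Summits.QuantumFields.YangMills.Theses.SteinGapBootstrap
import Summits.QuantumFields.YangMills.Theorems.EquipartitionCriticalityEquipartitionPinsProbeTangentFieldMoments
import Summits.QuantumFields.YangMills.Theorems.EquipartitionCriticalityEquipartitionPinsProbeLocalLaw
import Literature.MathematicalPhysics.QuantumFieldTheory.LatticeMaxwellBlockOU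
import Literature.MathematicalPhysics.QuantumFieldTheory.CurvatureGaussianField
import HarnessLib

/-!
# Route `SteinGapBootstrap`, crux `UProbeCovFromPairLaw` (stmt-QuantumFields-23800 ≡ `ProbeCovFromPairLawG` 23640),
# line `direct`: STUB `stub_assembly` — the bookkeeping

NOT THE CLAY GAP: the route bears on the RECORD-label rung leaf R2ξ′ `WeakCouplingRates.XiPow` (an upper bound on the
lattice mass gap of torus-limit states); nothing here proves a summit statement.

`stub_assembly h₁ h₂ h₃ : ProbeCovFromPairLawG` composes the three lemmas of line `direct`:
* `h₁` (lattice side, pointwise): `|exp(−2(βE_p)₊) − exp(−|Y_p|²)| ≤ K √β E_p` at the `(1,2)`-plaquettes of the `e₀` axis;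
* `h₂` (test functions): `z ↦ e^{−|z_p|²}` and `z ↦ e^{−|z_p|²}e^{−|z_q|²}` on the block space have `C²` norms `≤ L(D)`;
* `h₃` (Gaussian side): `Cov_{γ_B}(e^{−|z_p|²}, e^{−|z_q|²}) = 2^{−D}((1 − c²)^{−D/2} − 1)`, `c = curvatureTwoPoint p q`;
into `|Cov_μ(P, P∘τ_n) − g_D(n)| ≤ Cη + Cβ^{−1/2}` with `C = 3L + 4K C₀⁺ + 1`, `β₀ = 1`:
`E_μ|P − e^{−|Y_{p₀}|²}| ≤ K√β E_μ E_{p₀} ≤ K C₀⁺ β^{−1/2}` (equipartition), the same at `p_n` (`P∘τ_n` reads the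
plaquette `p_n` exactly, `timeShiftLG n = configShift(−n e₀)`), all four functions take values in `[0, 1]`, so the two
covariances differ by `≤ 4 K C₀⁺ β^{−1/2}`; the hypothesis on `h/L` for the three test functions gives
`|Cov_μ(e^{−|Y_{p₀}|²}, e^{−|Y_{p_n}|²}) − Cov_{γ_B}| ≤ 3Lη`; and `c = c_n` by `rfl`.

References: E. Meckes, IMS Collections 5 (2009) 153–178 [Meckes2009]; S. Chatterjee, arXiv:1602.01222 §§9–11
[arXiv160201222].
-/

set_option autoImplicit false

noncomputable section

namespace Summit.QuantumFields.YangMills.Theorems.SteinGapBootstrap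

open MeasureTheory
open Literature.MathematicalPhysics.QuantumLattice Literature.MathematicalPhysics.QuantumFieldTheory
open Summit.QuantumFields.YangMills.Theorems.EquipartitionPinsProbe
open Summit.QuantumFields.YangMills.Theses.SteinGapBootstrap

namespace ProbeCovDirect

/-! ### Elementary bookkeeping lemmas -/

/-- `|ab − a'b'| ≤ |a − a'| + |b − b'|` when `|a'| ≤ 1` and `|b| ≤ 1`. [folklore] -/
theorem abs_mul_sub_mul_le {a b a' b' : ℝ} (ha' : |a'| ≤ 1) (hb : |b| ≤ 1) :
    |a * b - a' * b'| ≤ |a - a'| + |b - b'| := by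
  have h : a * b - a' * b' = (a - a') * b + a' * (b - b') := by ring
  rw [h]
  refine (abs_add_le _ _).trans (add_le_add ?_ ?_)
  · rw [abs_mul]
    exact (mul_le_mul_of_nonneg_left hb (abs_nonneg _)).trans_eq (mul_one _)
  · rw [abs_mul]
    exact (mul_le_mul_of_nonneg_right ha' (abs_nonneg _)).trans_eq (one_mul _)

/-- The probe value `exp(−2 x₊)` lies in `[0, 1]`. [folklore] -/
theorem probe_mem (x : ℝ) : 0 ≤ Real.exp (-2 * max x 0) ∧ Real.exp (-2 * max x 0) ≤ 1 :=
  ⟨(Real.exp_pos _).le, Real.exp_le_one_iff.2 (by nlinarith [le_max_right x 0])⟩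

/-- `exp(−Σ_a y_a²)` lies in `[0, 1]`. [folklore] -/
theorem gauss_mem {D : ℕ} (y : Fin D → ℝ) :
    0 ≤ Real.exp (-(∑ a, y a ^ 2)) ∧ Real.exp (-(∑ a, y a ^ 2)) ≤ 1 :=
  ⟨(Real.exp_pos _).le, Real.exp_le_one_iff.2 (by linarith [Finset.sum_nonneg fun a (_ : a ∈ Finset.univ) => sq_nonneg (y a)])⟩

variable {Ω : Type*} [MeasurableSpace Ω]

/-- A measurable function with values in `[0, 1]` is integrable for a probability measure and its integral has
absolute value `≤ 1`. [folklore] -/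
theorem integrable_and_abs_integral_le_one (μ : Measure Ω) [IsProbabilityMeasure μ] {f : Ω → ℝ}
    (hf : Measurable f) (h0 : ∀ ω, 0 ≤ f ω) (h1 : ∀ ω, f ω ≤ 1) :
    Integrable f μ ∧ |∫ ω, f ω ∂μ| ≤ 1 := by
  have hint : Integrable f μ := Integrable.of_bound hf.aestronglyMeasurable 1
    (ae_of_all μ fun ω => by rw [Real.norm_eq_abs, abs_of_nonneg (h0 ω)]; exact h1 ω)
  refine ⟨hint, ?_⟩
  rw [abs_of_nonneg (integral_nonneg h0)]
  calc ∫ ω, f ω ∂μ ≤ ∫ _ω, (1 : ℝ) ∂μ := integral_mono hint (integrable_const _) h1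
    _ = 1 := by simp

/-- **Covariance transfer**: if `f, g, f', g'` take values in `[0, 1]`, `E|f − f'| ≤ A` and `E|g − g'| ≤ A`, then
`|Cov(f, g) − Cov(f', g')| ≤ 4A` (covariances written out). [folklore] -/
theorem abs_cov_sub_cov_le (μ : Measure Ω) [IsProbabilityMeasure μ] {f g f' g' : Ω → ℝ}
    (hf : Measurable f) (hg : Measurable g) (hf' : Measurable f') (hg' : Measurable g')
    (hf0 : ∀ ω, 0 ≤ f ω) (hf1 : ∀ ω, f ω ≤ 1) (hg0 : ∀ ω, 0 ≤ g ω) (hg1 : ∀ ω, g ω ≤ 1)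
    (hf'0 : ∀ ω, 0 ≤ f' ω) (hf'1 : ∀ ω, f' ω ≤ 1) (hg'0 : ∀ ω, 0 ≤ g' ω) (hg'1 : ∀ ω, g' ω ≤ 1)
    {A : ℝ} (hA : ∫ ω, |f ω - f' ω| ∂μ ≤ A) (hB : ∫ ω, |g ω - g' ω| ∂μ ≤ A) :
    |((∫ ω, f ω * g ω ∂μ) - (∫ ω, f ω ∂μ) * (∫ ω, g ω ∂μ)) -
        ((∫ ω, f' ω * g' ω ∂μ) - (∫ ω, f' ω ∂μ) * (∫ ω, g' ω ∂μ))| ≤ 4 * A := by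
  obtain ⟨hfi, hfI⟩ := integrable_and_abs_integral_le_one μ hf hf0 hf1
  obtain ⟨hgi, hgI⟩ := integrable_and_abs_integral_le_one μ hg hg0 hg1
  obtain ⟨hf'i, hf'I⟩ := integrable_and_abs_integral_le_one μ hf' hf'0 hf'1
  obtain ⟨hg'i, hg'I⟩ := integrable_and_abs_integral_le_one μ hg' hg'0 hg'1
  have hfg : Integrable (fun ω => f ω * g ω) μ :=
    (integrable_and_abs_integral_le_one μ (hf.mul hg) (fun ω => mul_nonneg (hf0 ω) (hg0 ω))
      (fun ω => mul_le_one₀ (hf1 ω) (hg0 ω) (hg1 ω))).1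
  have hf'g' : Integrable (fun ω => f' ω * g' ω) μ :=
    (integrable_and_abs_integral_le_one μ (hf'.mul hg') (fun ω => mul_nonneg (hf'0 ω) (hg'0 ω))
      (fun ω => mul_le_one₀ (hf'1 ω) (hg'0 ω) (hg'1 ω))).1
  have hdf : Integrable (fun ω => |f ω - f' ω|) μ := (hfi.sub hf'i).abs
  have hdg : Integrable (fun ω => |g ω - g' ω|) μ := (hgi.sub hg'i).abs
  -- the product term
  have h1 : |(∫ ω, f ω * g ω ∂μ) - ∫ ω, f' ω * g' ω ∂μ| ≤ 2 * A := by
    rw [← integral_sub hfg hf'g']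
    calc |∫ ω, (f ω * g ω - f' ω * g' ω) ∂μ| ≤ ∫ ω, |f ω * g ω - f' ω * g' ω| ∂μ := abs_integral_le_integral_abs
      _ ≤ ∫ ω, (|f ω - f' ω| + |g ω - g' ω|) ∂μ := by
          refine integral_mono_of_nonneg (ae_of_all μ fun ω => abs_nonneg _) (hdf.add hdg)
            (ae_of_all μ fun ω => ?_)
          exact abs_mul_sub_mul_le (by rw [abs_of_nonneg (hf'0 ω)]; exact hf'1 ω)
            (by rw [abs_of_nonneg (hg0 ω)]; exact hg1 ω)
      _ = (∫ ω, |f ω - f' ω| ∂μ) + ∫ ω, |g ω - g' ω| ∂μ := integral_add hdf hdg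
      _ ≤ 2 * A := by linarith
  -- the means
  have h2 : |(∫ ω, f ω ∂μ) - ∫ ω, f' ω ∂μ| ≤ A := by
    rw [← integral_sub hfi hf'i]
    exact abs_integral_le_integral_abs.trans hA
  have h3 : |(∫ ω, g ω ∂μ) - ∫ ω, g' ω ∂μ| ≤ A := by
    rw [← integral_sub hgi hg'i]
    exact abs_integral_le_integral_abs.trans hB
  have h4 : |(∫ ω, f ω ∂μ) * (∫ ω, g ω ∂μ) - (∫ ω, f' ω ∂μ) * (∫ ω, g' ω ∂μ)| ≤ 2 * A :=
    (abs_mul_sub_mul_le hf'I hgI).trans (by linarith)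
  calc _ = |((∫ ω, f ω * g ω ∂μ) - ∫ ω, f' ω * g' ω ∂μ) -
        ((∫ ω, f ω ∂μ) * (∫ ω, g ω ∂μ) - (∫ ω, f' ω ∂μ) * (∫ ω, g' ω ∂μ))| := by ring_nf
    _ ≤ 2 * A + 2 * A := (abs_sub _ _).trans (add_le_add h1 h4)
    _ = 4 * A := by ring

/-- **Smooth-metric transfer of a covariance**: if `|E_μ u − E_ν a| ≤ δ`, `|E_μ v − E_ν b| ≤ δ`, `|E_μ uv − E_ν ab| ≤ δ` and
`|E_μ v| ≤ 1`, `|E_ν a| ≤ 1`, then the covariances differ by `≤ 3δ` (pure real arithmetic). [folklore] -/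
theorem abs_cov_transfer {x y xy a b ab δ : ℝ} (h1 : |x - a| ≤ δ) (h2 : |y - b| ≤ δ) (h3 : |xy - ab| ≤ δ)
    (hy : |y| ≤ 1) (ha : |a| ≤ 1) :
    |(xy - x * y) - (ab - a * b)| ≤ 3 * δ := by
  have h4 : |x * y - a * b| ≤ 2 * δ := by
    have h : x * y - a * b = (x - a) * y + a * (y - b) := by ring
    rw [h]
    refine (abs_add_le _ _).trans ?_
    rw [abs_mul, abs_mul]
    nlinarith [abs_nonneg (x - a), abs_nonneg (y - b), mul_le_mul_of_nonneg_left hy (abs_nonneg (x - a)),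
      mul_le_mul_of_nonneg_right ha (abs_nonneg (y - b))]
  calc _ = |(xy - ab) - (x * y - a * b)| := by ring_nf
    _ ≤ δ + 2 * δ := (abs_sub _ _).trans (add_le_add h3 h4)
    _ = 3 * δ := by ring

/-! ### The assembly -/

/-- STUB `stub_assembly` of line `direct` (crux stmt-QuantumFields-23800 ≡ 23640) — **bookkeeping**: the lattice-side
pointwise probe bound, the `C²` bounds of the Gaussian test functions and the Gaussian covariance formula give
`ProbeCovFromPairLawG` with `δ = 1/2`, `C = 3L + 4K C₀⁺ + 1`, `β₀ = 1`. -/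
theorem stub_assembly
    (h₁ : ∀ (G : Type) [Group G] [TopologicalSpace G] [CompactSpace G]
      (r : Literature.MathematicalPhysics.QuantumFieldTheory.LatticeRep G), ∃ K : ℝ, 0 ≤ K ∧
      ∀ (β : ℝ), 0 < β → ∀ (x : Literature.Probability.LatticeModels.Site 4), (∀ j : Fin 4, 1 < j → x j = 0) →
        ∀ U : Literature.MathematicalPhysics.QuantumLattice.LGConfig 4 G,
          |Real.exp (-2 * max (β * ((r.N : ℝ) - Literature.MathematicalPhysics.QuantumLattice.plaquetteObs r.ρ x 1 2 U)) 0) -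
              Real.exp (-(∑ a : Fin (Summit.QuantumFields.YangMills.Theorems.EquipartitionPinsProbe.lieDim r),
                (Summit.QuantumFields.YangMills.Theorems.EquipartitionPinsProbe.plaqField r β U
                  (Literature.MathematicalPhysics.QuantumFieldTheory.plaquette12 (d := 4) (by norm_num) x) a) ^ 2))| ≤
            K * Real.sqrt β * ((r.N : ℝ) - Literature.MathematicalPhysics.QuantumLattice.plaquetteObs r.ρ x 1 2 U))
    (h₂ : ∀ (D : ℕ), ∃ L : ℝ, 0 < L ∧
      ∀ (B : Finset (Literature.MathematicalPhysics.QuantumLattice.ZdPlaquette 4)) (p q : ↥B),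
        (ContDiff ℝ (⊤ : ℕ∞) (fun z : ↥B → Fin D → ℝ => Real.exp (-(∑ a : Fin D, (z p a) ^ 2))) ∧
          ∀ z : ↥B → Fin D → ℝ,
            ‖fderiv ℝ (fun z : ↥B → Fin D → ℝ => Real.exp (-(∑ a : Fin D, (z p a) ^ 2))) z‖ ≤ L ∧
            ‖iteratedFDeriv ℝ 2 (fun z : ↥B → Fin D → ℝ => Real.exp (-(∑ a : Fin D, (z p a) ^ 2))) z‖ ≤ L) ∧
        (ContDiff ℝ (⊤ : ℕ∞) (fun z : ↥B → Fin D → ℝ =>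
            Real.exp (-(∑ a : Fin D, (z p a) ^ 2)) * Real.exp (-(∑ a : Fin D, (z q a) ^ 2))) ∧
          ∀ z : ↥B → Fin D → ℝ,
            ‖fderiv ℝ (fun z : ↥B → Fin D → ℝ =>
                Real.exp (-(∑ a : Fin D, (z p a) ^ 2)) * Real.exp (-(∑ a : Fin D, (z q a) ^ 2))) z‖ ≤ L ∧
            ‖iteratedFDeriv ℝ 2 (fun z : ↥B → Fin D → ℝ =>
                Real.exp (-(∑ a : Fin D, (z p a) ^ 2)) * Real.exp (-(∑ a : Fin D, (z q a) ^ 2))) z‖ ≤ L))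
    (h₃ : ∀ (B : Finset (Literature.MathematicalPhysics.QuantumLattice.ZdPlaquette 4)) (D : ℕ) (p q : ↥B),
      (∫ z, Real.exp (-(∑ a : Fin D, (z p a) ^ 2)) * Real.exp (-(∑ a : Fin D, (z q a) ^ 2))
          ∂(Literature.MathematicalPhysics.QuantumFieldTheory.latticeMaxwellBlockLaw B D)) -
        (∫ z, Real.exp (-(∑ a : Fin D, (z p a) ^ 2))
          ∂(Literature.MathematicalPhysics.QuantumFieldTheory.latticeMaxwellBlockLaw B D)) *
        (∫ z, Real.exp (-(∑ a : Fin D, (z q a) ^ 2))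
          ∂(Literature.MathematicalPhysics.QuantumFieldTheory.latticeMaxwellBlockLaw B D)) =
      (2 : ℝ) ^ (-(D : ℝ)) *
        ((1 - (Literature.MathematicalPhysics.QuantumFieldTheory.curvatureTwoPoint (d := 4)
          (p : Literature.MathematicalPhysics.QuantumLattice.ZdPlaquette 4) q) ^ 2) ^ (-((D : ℝ) / 2)) - 1)) :
    Summit.QuantumFields.YangMills.Theses.SteinGapBootstrap.ProbeCovFromPairLawG := by
  intro G _ _ _ _ hG
  letI : MeasurableSpace G := borel G
  haveI : BorelSpace G := ⟨rfl⟩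
  intro r C₀
  haveI : SecondCountableTopology G :=
    (r.continuous.isClosedEmbedding r.injective).isEmbedding.secondCountableTopology
  obtain ⟨K, hK0, hK⟩ := h₁ G r
  obtain ⟨L, hL0, hL⟩ := h₂ (lieDim r)
  refine ⟨1 / 2, 3 * L + 4 * K * max C₀ 0 + 1, 1, by norm_num, by positivity, ?_⟩
  intro β hβ μ hμ hequi n hn η hη B YB hH P D c₂
  have hβ0 : 0 < β := by linarith
  haveI : IsProbabilityMeasure μ := by
    obtain ⟨Ls, -, hprob, -⟩ := hμ
    exact hprob
  -- the two plaquettes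
  set p0 : ZdPlaquette 4 := plaquette12 (d := 4) (by norm_num) 0 with hp0
  set pn : ZdPlaquette 4 := plaquette12 (d := 4) (by norm_num) (Pi.single (0 : Fin 4) (n : ℤ)) with hpn
  have hp0B : p0 ∈ B := Finset.mem_insert_self _ _
  have hpnB : pn ∈ B := Finset.mem_insert_of_mem (Finset.mem_singleton_self _)
  set b0 : ↥B := ⟨p0, hp0B⟩ with hb0
  set bn : ↥B := ⟨pn, hpnB⟩ with hbn
  -- the four lattice observables: the probes `P`, `P ∘ τ_n` and the Gaussian tests of the plaquette field
  set En : LGConfig 4 G → ℝ := fun U =>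
    (r.N : ℝ) - plaquetteObs r.ρ (Pi.single (0 : Fin 4) (n : ℤ)) 1 2 U with hEn
  set E0 : LGConfig 4 G → ℝ := fun U => (r.N : ℝ) - plaquetteObs r.ρ 0 1 2 U with hE0
  set Pn : LGConfig 4 G → ℝ := fun U => Real.exp (-2 * max (β * En U) 0) with hPn
  set e0 : LGConfig 4 G → ℝ := fun U => Real.exp (-(∑ a, (plaqField r β U p0 a) ^ 2)) with he0
  set en : LGConfig 4 G → ℝ := fun U => Real.exp (-(∑ a, (plaqField r β U pn a) ^ 2)) with hen
  have hshift : ∀ U : LGConfig 4 G,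
      P (Summit.QuantumFields.YangMills.Theorems.WeakCouplingRates.timeShiftLG (G := G) n U) = Pn U := by
    intro U
    simp only [P, hPn, hEn, Summit.QuantumFields.YangMills.Theorems.WeakCouplingRates.timeShiftLG,
      TangentLocalLaw.plaquetteObs_configShift', zero_sub, neg_neg]
  -- measurability and values in `[0, 1]`
  have hEm : ∀ x : Literature.Probability.LatticeModels.Site 4,
      Measurable fun U : LGConfig 4 G => (r.N : ℝ) - plaquetteObs r.ρ x 1 2 U := fun x =>
    measurable_const.sub (measurable_plaquetteObs r.ρ r.continuous _ _ _)
  have hψm : ∀ x : Literature.Probability.LatticeModels.Site 4,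
      Measurable fun U : LGConfig 4 G =>
        Real.exp (-2 * max (β * ((r.N : ℝ) - plaquetteObs r.ρ x 1 2 U)) 0) := fun x =>
    Real.measurable_exp.comp ((((hEm x).const_mul β).max measurable_const).const_mul (-2))
  have hPm : Measurable P := hψm 0
  have hPnm : Measurable Pn := hψm _
  have hgm : ∀ p : ZdPlaquette 4,
      Measurable fun U : LGConfig 4 G => Real.exp (-(∑ a, (plaqField r β U p a) ^ 2)) := fun p =>
    (Real.continuous_exp.comp (continuous_finsetSum _ fun a _ =>
      TangentFieldMoments.continuous_plaqField_sq r β p a).neg).measurable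
  have he0m : Measurable e0 := hgm p0
  have henm : Measurable en := hgm pn
  have hP01 : ∀ U, 0 ≤ P U ∧ P U ≤ 1 := fun U => probe_mem _
  have hPn01 : ∀ U, 0 ≤ Pn U ∧ Pn U ≤ 1 := fun U => probe_mem _
  have he001 : ∀ U, 0 ≤ e0 U ∧ e0 U ≤ 1 := fun U => gauss_mem _
  have hen01 : ∀ U, 0 ≤ en U ∧ en U ≤ 1 := fun U => gauss_mem _
  -- LATTICE SIDE: `E_μ|P − e0| ≤ K C₀⁺ β^{-1/2}`, the same at `p_n`
  have hsqrt : Real.sqrt β / β = β ^ (-(1 / 2 : ℝ)) := by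
    rw [Real.sqrt_div_self, Real.sqrt_eq_rpow, Real.rpow_neg hβ0.le]
  have hside : ∀ x : Literature.Probability.LatticeModels.Site 4, (∀ j : Fin 4, 1 < j → x j = 0) →
      ∫ U, |Real.exp (-2 * max (β * ((r.N : ℝ) - plaquetteObs r.ρ x 1 2 U)) 0) -
          Real.exp (-(∑ a, (plaqField r β U (plaquette12 (d := 4) (by norm_num) x) a) ^ 2))| ∂μ ≤
        K * max C₀ 0 * β ^ (-(1 / 2 : ℝ)) := by
    intro x hx
    have hint : Integrable (fun U : LGConfig 4 G => (r.N : ℝ) - plaquetteObs r.ρ x 1 2 U) μ :=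
      TangentPlaquetteEnergy.integrable_sub_plaquetteObs r.ρ r.continuous r.mem_unitary μ x 1 2
    have h12 : (1 : Fin 4) ≠ 2 := by decide
    calc ∫ U, |Real.exp (-2 * max (β * ((r.N : ℝ) - plaquetteObs r.ρ x 1 2 U)) 0) -
          Real.exp (-(∑ a, (plaqField r β U (plaquette12 (d := 4) (by norm_num) x) a) ^ 2))| ∂μ
        ≤ ∫ U, K * Real.sqrt β * ((r.N : ℝ) - plaquetteObs r.ρ x 1 2 U) ∂μ :=
          integral_mono_of_nonneg (ae_of_all _ fun U => abs_nonneg _) (hint.const_mul _)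
            (ae_of_all _ fun U => hK β hβ0 x hx U)
      _ = K * Real.sqrt β * ∫ U, ((r.N : ℝ) - plaquetteObs r.ρ x 1 2 U) ∂μ := integral_const_mul _ _
      _ ≤ K * Real.sqrt β * (max C₀ 0 / β) :=
          mul_le_mul_of_nonneg_left ((hequi x 1 2 h12).trans
            (div_le_div_of_nonneg_right (le_max_left _ _) hβ0.le)) (by positivity)
      _ = K * max C₀ 0 * (Real.sqrt β / β) := by ring
      _ = K * max C₀ 0 * β ^ (-(1 / 2 : ℝ)) := by rw [hsqrt]
  have hI0 : ∫ U, |P U - e0 U| ∂μ ≤ K * max C₀ 0 * β ^ (-(1 / 2 : ℝ)) := hside 0 fun j _ => rfl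
  have hIn : ∫ U, |Pn U - en U| ∂μ ≤ K * max C₀ 0 * β ^ (-(1 / 2 : ℝ)) :=
    hside (Pi.single (0 : Fin 4) (n : ℤ)) fun j hj =>
      Pi.single_eq_of_ne (ne_of_gt (lt_trans Fin.zero_lt_one hj)) _
  have hcov1 := abs_cov_sub_cov_le μ hPm hPnm he0m henm (fun U => (hP01 U).1) (fun U => (hP01 U).2)
    (fun U => (hPn01 U).1) (fun U => (hPn01 U).2) (fun U => (he001 U).1) (fun U => (he001 U).2)
    (fun U => (hen01 U).1) (fun U => (hen01 U).2) hI0 hIn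
  -- STEIN SIDE: the hypothesis on `h / L` for the three Gaussian test functions
  set γ : Measure (↥B → Fin (lieDim r) → ℝ) := latticeMaxwellBlockLaw B (lieDim r) with hγ
  haveI : IsProbabilityMeasure γ := isProbabilityMeasure_latticeMaxwellBlockLaw B (lieDim r) (by norm_num)
  have key : ∀ (h : (↥B → Fin (lieDim r) → ℝ) → ℝ), ContDiff ℝ (⊤ : ℕ∞) h →
      (∀ z, ‖fderiv ℝ h z‖ ≤ L) → (∀ z, ‖iteratedFDeriv ℝ 2 h z‖ ≤ L) →
      |(∫ U, h (YB U) ∂μ) - ∫ z, h z ∂γ| ≤ L * η := by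
    intro h hh hd1 hd2
    have hdiff : Differentiable ℝ h := hh.differentiable (by simp)
    have hs : ContDiff ℝ (⊤ : ℕ∞) (fun z => L⁻¹ • h z) := hh.const_smul L⁻¹
    have hs1 : ∀ z, ‖fderiv ℝ (fun z => L⁻¹ • h z) z‖ ≤ 1 := fun z => by
      rw [fderiv_fun_const_smul (hdiff z) L⁻¹, norm_smul, Real.norm_eq_abs, abs_of_pos (inv_pos.2 hL0)]
      exact (mul_le_mul_of_nonneg_left (hd1 z) (inv_pos.2 hL0).le).trans_eq (inv_mul_cancel₀ hL0.ne')
    have hs2 : ∀ z, ‖iteratedFDeriv ℝ 2 (fun z => L⁻¹ • h z) z‖ ≤ 1 := fun z => by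
      have h2 : ContDiffAt ℝ 2 h z := (contDiff_infty.1 hh 2).contDiffAt
      rw [iteratedFDeriv_const_smul_apply' h2, norm_smul, Real.norm_eq_abs, abs_of_pos (inv_pos.2 hL0)]
      exact (mul_le_mul_of_nonneg_left (hd2 z) (inv_pos.2 hL0).le).trans_eq (inv_mul_cancel₀ hL0.ne')
    have hmain := hH (fun z => L⁻¹ • h z) hs hs1 hs2
    have e1 : (∫ U, (fun z => L⁻¹ • h z) (YB U) ∂μ) = L⁻¹ * ∫ U, h (YB U) ∂μ := by
      simp only [smul_eq_mul]
      exact integral_const_mul _ _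
    have e2 : (∫ z, (fun z => L⁻¹ • h z) z ∂γ) = L⁻¹ * ∫ z, h z ∂γ := by
      simp only [smul_eq_mul]
      exact integral_const_mul _ _
    rw [e1, e2, ← mul_sub, abs_mul, abs_of_pos (inv_pos.2 hL0)] at hmain
    have := mul_le_mul_of_nonneg_left hmain hL0.le
    rwa [← mul_assoc, mul_inv_cancel₀ hL0.ne', one_mul] at this
  obtain ⟨⟨ha_s, ha_b⟩, ⟨h2_s, h2_b⟩⟩ := hL B b0 bn
  obtain ⟨⟨hb_s, hb_b⟩, -⟩ := hL B bn b0
  have hxa : |(∫ U, e0 U ∂μ) - ∫ z, Real.exp (-(∑ a, (z b0 a) ^ 2)) ∂γ| ≤ L * η :=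
    key _ ha_s (fun z => (ha_b z).1) (fun z => (ha_b z).2)
  have hyb : |(∫ U, en U ∂μ) - ∫ z, Real.exp (-(∑ a, (z bn a) ^ 2)) ∂γ| ≤ L * η :=
    key _ hb_s (fun z => (hb_b z).1) (fun z => (hb_b z).2)
  have hxyab : |(∫ U, e0 U * en U ∂μ) -
      ∫ z, Real.exp (-(∑ a, (z b0 a) ^ 2)) * Real.exp (-(∑ a, (z bn a) ^ 2)) ∂γ| ≤ L * η :=
    key _ h2_s (fun z => (h2_b z).1) (fun z => (h2_b z).2)
  have hy1 : |∫ U, en U ∂μ| ≤ 1 :=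
    (integrable_and_abs_integral_le_one μ henm (fun U => (hen01 U).1) (fun U => (hen01 U).2)).2
  have ha1 : |∫ z, Real.exp (-(∑ a, (z b0 a) ^ 2)) ∂γ| ≤ 1 :=
    (integrable_and_abs_integral_le_one γ ha_s.continuous.measurable (fun z => (gauss_mem _).1)
      (fun z => (gauss_mem _).2)).2
  have hcov2 := abs_cov_transfer hxa hyb hxyab hy1 ha1
  -- GAUSSIAN SIDE
  have hcov3 := h₃ B (lieDim r) b0 bn
  have hg : (2 : ℝ) ^ (-D) * ((1 - c₂ ^ 2) ^ (-(D / 2)) - 1) =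
      (2 : ℝ) ^ (-((lieDim r : ℕ) : ℝ)) *
        ((1 - (curvatureTwoPoint (d := 4) (b0 : ZdPlaquette 4) bn) ^ 2) ^ (-(((lieDim r : ℕ) : ℝ) / 2)) - 1) := by
    rfl
  -- conclusion
  simp only [hshift]
  rw [hg, ← hcov3]
  have hb : 0 < β ^ (-(1 / 2 : ℝ)) := Real.rpow_pos_of_pos hβ0 _
  have hC1 : 3 * (L * η) ≤ (3 * L + 4 * K * max C₀ 0 + 1) * η := by
    have : 0 ≤ (4 * K * max C₀ 0 + 1) * η := by positivity
    nlinarith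
  have hC2 : 4 * (K * max C₀ 0 * β ^ (-(1 / 2 : ℝ))) ≤ (3 * L + 4 * K * max C₀ 0 + 1) * β ^ (-(1 / 2 : ℝ)) := by
    have : 0 ≤ (3 * L + 1) * β ^ (-(1 / 2 : ℝ)) := by positivity
    nlinarith
  calc _ ≤ |((∫ U, P U * Pn U ∂μ) - (∫ U, P U ∂μ) * (∫ U, Pn U ∂μ)) -
          ((∫ U, e0 U * en U ∂μ) - (∫ U, e0 U ∂μ) * (∫ U, en U ∂μ))| +
        |((∫ U, e0 U * en U ∂μ) - (∫ U, e0 U ∂μ) * (∫ U, en U ∂μ)) -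
          ((∫ z, Real.exp (-(∑ a, (z b0 a) ^ 2)) * Real.exp (-(∑ a, (z bn a) ^ 2)) ∂γ) -
            (∫ z, Real.exp (-(∑ a, (z b0 a) ^ 2)) ∂γ) * (∫ z, Real.exp (-(∑ a, (z bn a) ^ 2)) ∂γ))| :=
        abs_sub_le _ _ _
    _ ≤ 4 * (K * max C₀ 0 * β ^ (-(1 / 2 : ℝ))) + 3 * (L * η) := add_le_add hcov1 hcov2
    _ ≤ _ := by linarith

end ProbeCovDirect

end Summit.QuantumFields.YangMills.Theorems.SteinGapBootstrap

end
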